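import Summits.Parity.BatemanHorn.Theorems.SelbergDelangeRigidityLSDRealSegmentTailsTwoBalAux
import Summits.Parity.BatemanHorn.Theorems.SelbergDelangeRigidityLSDRealSegmentTailsLinear
import HarnessLib

/-!
# Route `SelbergDelangeRigidity`, crux `LSDRealSegment` (stmt-Parity-9770), line
# `product-anatomy-subcritical`: clause (d) of `stub_tailsTwo` for ONE QUADRATIC (the balanced class) FROM THE ENGINE

`tailsTwo_balanced_quadratic_of_engine` (registered helper): clause (d) of `stub_tailsTwo`, `BalancedClassBound k f y` (`k = 1`), for a Bateman–Horn
system `f` of total degree `2` and `1 ≤ y < 2` — the landed `tailsTwo_balanced_quadratic` (`…TailsTwoBalQ.lean`: same proof, its helpers reused) made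
UNCONDITIONAL by taking as hypotheses (E) the conclusion of the small-prime restoration engine for `(f, y)` (the body of `tailsTwo_engine` at `B = 1`,
every `A ≥ 1` and cut `P`) and clause (a) `APrioriBound k f y`.  Purpose: the engine's named inputs changed (`NairTenenbaum1998_theorem1` is MISSTATED
— Henriot's `α < 1` vs the printed `α < 1/2`, Erratum 2 of `NairTenenbaumShortSums.lean`; the engine needs `α = 1/4` — and
`BugeaudEvertseGyory2018_SPartPolynomialValues` is now proved); the clause is re-assembled on `NairTenenbaum1998_theorem1_printed` in
`…TailsTwoPrinted.lean`.
-/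

open Filter Finset Polynomial
open scoped BigOperators Topology Classical

namespace Summit.Parity.BatemanHorn.Cruxes.LSDRealSegment.ProductAnatomySubcritical

open Literature.NumberTheory.Sieve
open ArithmeticFunction (cardFactors)
noncomputable section

set_option maxHeartbeats 3000000 in
/-- **tailsTwo_balanced_quadratic_of_engine** (registered helper of `stub_tailsTwo`, line `product-anatomy-subcritical`): clause (d) of
`stub_tailsTwo`, `BalancedClassBound k f y` (`k = 1`), in total degree `2`, `1 ≤ y < 2`, GIVEN (E) the engine bound for `(f, y)` (body of
`tailsTwo_engine`, `B = 1`) and clause (a) `APrioriBound k f y`; proof of `tailsTwo_balanced_quadratic` verbatim. [folklore] -/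
theorem tailsTwo_balanced_quadratic_of_engine : ∀ (k : ℕ) (f : Fin k → ℤ[X]), IsBatemanHornSystem f → (∑ i, (f i).natDegree) = 2 → k = 1 →
    ∀ y : ℝ, 1 ≤ y → y < 2 →
    (∀ (A : ℝ) (P : ℕ), 1 ≤ A → ∃ C : ℝ, ∃ X₀ : ℕ, 0 ≤ C ∧ ∀ (F : Fin k → ℕ → ℝ),
      (∀ i, IsClassM A 1 ((1 - Real.logb 2 y) / (9216 * (k + 1))) (F i)) → (∀ i m, F i m = F i (roughPart (P : ℝ) m)) →
      (∀ i, F i 1 ≤ 1) → ∀ (𝒮 : (Fin k → ℕ) → Prop) (X : ℕ), X₀ ≤ X →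
        (∑ n ∈ (Finset.Ioc X (2 * X)).filter (fun n => 𝒮 (fun i => smoothPart (P : ℝ) (val f i n))),
            ∏ i, (y ^ cardFactors (smoothPart (P : ℝ) (val f i n)) * F i (val f i n))) ≤
          C * ((X : ℝ) / Real.log X ^ k) * (∏ i, ∑ m ∈ Finset.Icc 1 (2 * X), F i m * (polyRootCountMod ![f i] m : ℝ) / m) *
              (∑ s ∈ (Fintype.piFinset fun _ : Fin k => Finset.Icc 1 X).filter (fun s => (∀ i, ∀ p ∈ (s i).primeFactors, p ≤ P) ∧ 𝒮 s),
                y ^ cardFactors (∏ i, s i) * (#((Finset.range (Finset.univ.lcm s * primorial P)).filter (fun r : ℕ =>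
                  ∀ i, ((s i : ℕ) : ℤ) ∣ (f i).eval (r : ℤ) ∧ ∀ p ∈ Nat.primesLE P, ¬ ((p ^ ((s i).factorization p + 1) : ℕ) : ℤ) ∣ (f i).eval (r : ℤ))) : ℝ) /
                  ((Finset.univ.lcm s * primorial P : ℕ) : ℝ)) + (X : ℝ) ^ (1 - (1 - Real.logb 2 y) / 6)) →
    APrioriBound k f y → BalancedClassBound k f y := by
  intro k f hf hdeg hk y hy hy2 hE hApr ε hε
  have hi₀k : 0 < k := by omega
  set i₀ : Fin k := ⟨0, hi₀k⟩ with hi₀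
  haveI hsub1 : Subsingleton (Fin k) := by subst hk; infer_instance
  have hprodVal : ∀ n, prodVal f n = val f i₀ n := fun n => by
    rw [prodVal, Fintype.prod_subsingleton _ i₀, val]
  have hdeg₀ : (f i₀).natDegree = 2 := by rw [← hdeg, Fintype.sum_subsingleton _ i₀]
  have hy0 : 0 ≤ y := by linarith
  have hk1 : 1 ≤ k := by rcases eq_one_or_two_of_sum_natDegree hf hdeg with rfl | rfl <;> omega
  set lam : ℝ := Real.logb 2 y with hlam
  have hlam1 : lam < 1 := by rw [hlam, Real.logb_lt_iff_lt_rpow one_lt_two (by linarith), Real.rpow_one]; exact hy2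
  set θ : ℝ := (1 - lam) / 6 with hθdef
  have hθ : 0 < θ := by rw [hθdef]; linarith
  set ε₁ : ℝ := (1 - Real.logb 2 y) / (9216 * (k + 1)) with hε₁def
  have hε₁ : 0 < ε₁ := by rw [hε₁def]; exact div_pos (by rw [← hlam]; linarith) (by positivity)
  set P : ℕ := ⌊y ^ (1 / ε₁)⌋₊ + 1 with hPdef
  have hP1 : 1 ≤ P := by omega
  have hPr : (1 : ℝ) ≤ P := by exact_mod_cast hP1
  have hyP : y ≤ (P : ℝ) ^ ε₁ := by
    have h1 : y ^ (1 / ε₁) ≤ (P : ℝ) := by rw [hPdef]; push_cast; exact (Nat.lt_floor_add_one _).le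
    calc y = (y ^ (1 / ε₁)) ^ ε₁ := by rw [← Real.rpow_mul hy0, one_div_mul_cancel hε₁.ne', Real.rpow_one]
      _ ≤ (P : ℝ) ^ ε₁ := Real.rpow_le_rpow (by positivity) h1 hε₁.le
  obtain ⟨hclsP, hFr, hF1, hFle⟩ := peeledWeight_props hy hε₁ hP1 hyP
  have hclsP' : IsClassM (3 * y) 1 ε₁ (fun m => y ^ cardFactors (roughPart (P : ℝ) m)) := IsClassM.mono_A hy0 (by linarith) hclsP
  obtain ⟨C, X₀, hC0, hengine⟩ := hE (3 * y) P (by linarith)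
  obtain ⟨Ch', hCh'⟩ := tails_rootCountHarmonic_le k f hf y hy hy2
  obtain ⟨Cs, hCs0, hCs⟩ := harmonic_smooth hf hy hy2
  set Cm : ℝ := max (max Ch' 0) Cs with hCmdef
  have hCm0 : 0 ≤ Cm := le_trans (le_max_right _ _) (le_max_left _ _)
  obtain ⟨Kz, hKz0, hKz⟩ := tailsTwo_classDensity_le k f hf hdeg P
  obtain ⟨⟨Ks, hKs⟩, -⟩ := tailsTwo_smoothSeries y P hy hy2
  have hKs0 : 0 ≤ Ks := le_trans (Finset.sum_nonneg fun m _ => by positivity) (hKs 1)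
  obtain ⟨Ca, hCa⟩ := hApr
  obtain ⟨Cρ, hCρ⟩ := exists_polyRootCountMod_prime_pow_le_of_system hf
  have hρj : ∀ (j : Fin k) (p : ℕ), p.Prime → polyRootCountMod ![f j] p ≤ Cρ := by
    intro j p hp
    have h3 := hCρ p hp 1; rw [pow_one] at h3
    refine le_trans ?_ h3
    rw [polyRootCountMod_single]; unfold polyRootCountMod
    refine Finset.card_le_card fun n hn => ?_
    rw [Finset.mem_filter] at hn ⊢
    exact ⟨hn.1, hn.2.trans (Finset.dvd_prod_of_mem (fun i => (f i).eval (n : ℤ)) (Finset.mem_univ j))⟩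
  have hρj2 : ∀ (j : Fin k) (p : ℕ), p.Prime → polyRootCountMod ![f j] (p ^ 2) ≤ Cρ := by
    intro j p hp
    refine le_trans ?_ (hCρ p hp 2)
    rw [polyRootCountMod_single]; unfold polyRootCountMod
    refine Finset.card_le_card fun n hn => ?_
    rw [Finset.mem_filter] at hn ⊢
    exact ⟨hn.1, hn.2.trans (Finset.dvd_prod_of_mem (fun i => (f i).eval (n : ℤ)) (Finset.mem_univ j))⟩
  obtain ⟨KM, hKM0, hKM⟩ := sum_inv_primes_window_le
  obtain ⟨Hc, hHc1, hHc⟩ := val_le_height_pow f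
  have hHcr : (1 : ℝ) ≤ Hc := by exact_mod_cast hHc1
  set e : ℝ := (k : ℝ) * (y - 1) with he
  have he0 : 0 ≤ e := by positivity
  set D : ℝ := C * 2 ^ k * (Cm * 2 ^ y) ^ k * (Kz * (Ks + 1) ^ k) with hD
  have hD0 : 0 ≤ D := by positivity
  set Kη : ℝ := 4 * k * y ^ 2 * D * (2 * (1 + 2 * Cρ) ^ 2 + 48 * Cρ ^ 2) + 1 with hKη
  have hKη0 : 0 < Kη := by positivity
  set η : ℝ := min (1 / 4) ((ε / Kη) ^ 2) with hηdef
  have hη0 : 0 < η := lt_min (by norm_num) (by positivity)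
  have hη4 : η ≤ 1 / 4 := min_le_left _ _
  have hηs : η ^ (1 / 2 : ℝ) ≤ ε / Kη := by
    have h1 : η ≤ (ε / Kη) ^ 2 := min_le_right _ _
    calc η ^ (1 / 2 : ℝ) ≤ ((ε / Kη) ^ 2) ^ (1 / 2 : ℝ) := Real.rpow_le_rpow hη0.le h1 (by norm_num)
      _ = ε / Kη := by rw [show (1 / 2 : ℝ) = ((2 : ℕ) : ℝ)⁻¹ by norm_num]; exact Real.pow_rpow_inv_natCast (by positivity) two_ne_zero
  set U₀ : ℝ := 1 + Cρ * (Real.log (2 / η) + 1) + Cρ with hU₀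
  set Bη : ℝ := U₀ ^ 2 with hBη
  have hlog2η : 0 ≤ Real.log (2 / η) := Real.log_nonneg (by rw [le_div_iff₀ hη0]; linarith)
  have hU₀1 : 1 ≤ U₀ := by rw [hU₀]; have : (0 : ℝ) ≤ Cρ := Nat.cast_nonneg _; nlinarith
  have hBη1 : 1 ≤ Bη := by rw [hBη]; nlinarith
  have hE₁ : (k : ℝ) * y ^ 2 * D * (η ^ y * Bη) ≤ ε / 4 := by
    have h1 := eta_bound_two hη0 (by linarith) hy (Nat.cast_nonneg Cρ)
    calc (k : ℝ) * y ^ 2 * D * (η ^ y * Bη) ≤ (k : ℝ) * y ^ 2 * D * ((2 * (1 + 2 * Cρ) ^ 2 + 48 * Cρ ^ 2) * η ^ (1 / 2 : ℝ)) :=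
          mul_le_mul_of_nonneg_left h1 (by positivity)
      _ ≤ (k : ℝ) * y ^ 2 * D * ((2 * (1 + 2 * Cρ) ^ 2 + 48 * Cρ ^ 2) * (ε / Kη)) := by gcongr
      _ = (4 * k * y ^ 2 * D * (2 * (1 + 2 * Cρ) ^ 2 + 48 * Cρ ^ 2)) / Kη * (ε / 4) := by ring
      _ ≤ 1 * (ε / 4) := by
          refine mul_le_mul_of_nonneg_right ?_ (by positivity)
          rw [div_le_one hKη0, hKη]; linarith
      _ = ε / 4 := one_mul _
  refine ⟨η / 2, by positivity, ?_⟩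
  have hCa0 : 0 ≤ Ca := by
    have h := hCa 2 le_rfl
    have h0 : 0 ≤ ∑ n ∈ Finset.range (2 + 1), y ^ stat f n := Finset.sum_nonneg fun n _ => by positivity
    have hl : 0 < ((2 : ℕ) : ℝ) * Real.log ((2 : ℕ) : ℝ) ^ e := by have : 0 < Real.log ((2 : ℕ) : ℝ) := Real.log_pos (by norm_num); positivity
    by_contra hneg; push Not at hneg
    have := mul_neg_of_neg_of_pos hneg hl; linarith
  have hl2e : 0 < Real.log 2 ^ e := Real.rpow_pos_of_pos (Real.log_pos one_lt_two) e
  obtain ⟨x₀, hx₀⟩ := Filter.eventually_atTop.mp (top_eventually X₀ (max (Real.log (4 * Hc)) (2 * KM)) (Real.log (4 * Hc) + 1)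
    (P + 2 : ℝ) (16 * (Ca + 1) / ε) (32 * k * y ^ 2 / (ε * Real.log 2 ^ e)) hη0 (by linarith) (half_pos hθ))
  refine Filter.eventually_atTop.mpr ⟨x₀, fun x hx => ?_⟩
  obtain ⟨c1, c2, c3, c4, c5, c6, c7, c8⟩ := hx₀ x hx
  have hx8 : (8 : ℝ) ≤ x := by exact_mod_cast c2
  have hxpos : (0 : ℝ) < x := by linarith
  have hx1 : (1 : ℝ) < x := by linarith
  have hlogx : 0 < Real.log x := Real.log_pos hx1
  have hlog2x : Real.log 2 ≤ Real.log x := Real.log_le_log two_pos (by linarith)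
  set w : ℝ := 4 * Hc * (x : ℝ) ^ η with hwdef
  have hxη1 : (1 : ℝ) ≤ (x : ℝ) ^ η := Real.one_le_rpow hx1.le hη0.le
  have hw4 : (4 : ℝ) ≤ w := by rw [hwdef]; nlinarith
  have hPw : (P : ℝ) ≤ w := by rw [hwdef]; nlinarith [c5]
  have hlogw : Real.log w = Real.log (4 * Hc) + η * Real.log x := by rw [hwdef, Real.log_mul (by positivity) (by positivity), Real.log_rpow hxpos]
  have hlogw1 : η * Real.log x ≤ Real.log w := by rw [hlogw]; linarith [Real.log_nonneg (show (1 : ℝ) ≤ 4 * Hc by linarith)]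
  have hlogw2 : Real.log w ≤ 2 * (η * Real.log x) := by rw [hlogw]; linarith [le_trans (le_max_left _ _) c3]
  have hlogw0 : 0 < Real.log w := lt_of_lt_of_le (by positivity) hlogw1
  have hwx : w < (x : ℝ) ^ (1 - η) := by
    rw [← Real.exp_log (show 0 < w by linarith), ← Real.exp_log (Real.rpow_pos_of_pos hxpos _), Real.exp_lt_exp, hlogw,
      Real.log_rpow hxpos]
    nlinarith [c4]
  set M : ℕ := ⌊(x : ℝ) ^ (1 / 2 : ℝ)⌋₊ + 1 with hMdef
  have hMsqrt : (x : ℝ) ^ (1 / 2 : ℝ) < M := by rw [hMdef]; push_cast; exact Nat.lt_floor_add_one _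
  have hMle : (M : ℝ) ≤ (x : ℝ) ^ (1 / 2 : ℝ) + 1 := by rw [hMdef]; push_cast; linarith [Nat.floor_le (Real.rpow_nonneg hxpos.le (1 / 2 : ℝ))]
  have hsqx : (x : ℝ) ^ (1 / 2 : ℝ) * (x : ℝ) ^ (1 / 2 : ℝ) = x := by rw [← Real.rpow_add hxpos]; norm_num
  have hMX₀ : X₀ ≤ M := by
    have : (X₀ : ℝ) ≤ M := by linarith
    exact_mod_cast this
  have hM1 : 1 ≤ M := by omega
  have h2Mx : 2 * M ≤ x := by
    have hs2 : (2 : ℝ) ≤ (x : ℝ) ^ (1 / 2 : ℝ) := by linarith [show (0 : ℝ) ≤ X₀ from Nat.cast_nonneg X₀]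
    have : 2 * (M : ℝ) ≤ x := by nlinarith
    exact_mod_cast this
  set Fp : Fin k → ℕ → ℝ := fun _ m => y ^ cardFactors (roughPart (P : ℝ) m) with hFp
  set FT : Fin k → Fin k → ℕ → ℝ := fun i j m => if j = i then y ^ cardFactors (smoothPart w (roughPart (P : ℝ) m)) *
    (if cardFactors (roughPart w (roughPart (P : ℝ) m)) ≤ 2 then (1 : ℝ) else 0) else y ^ cardFactors (roughPart (P : ℝ) m) with hFT
  have hFT0 : ∀ i j m, 0 ≤ FT i j m := fun i j m => by simp only [hFT]; split_ifs <;> positivity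
  set cls : ℕ → Prop := fun n => ∃ p ∈ (prodVal f n).primeFactors, ∃ q ∈ (prodVal f n).primeFactors,
    p ≠ q ∧ (x : ℝ) ^ (1 - η / 2) < (p : ℝ) ∧ (x : ℝ) ^ (1 - η / 2) < (q : ℝ) with hcls
  set wt : ℕ → ℝ := fun n => if cls n then y ^ stat f n else 0 with hwt
  have hwt0 : ∀ n, 0 ≤ wt n := fun n => by simp only [hwt]; split_ifs <;> positivity
  have hwtle : ∀ n, wt n ≤ y ^ stat f n := fun n => by simp only [hwt]; split_ifs <;> linarith [pow_nonneg hy0 (stat f n)]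
  obtain ⟨hclsT, hFrT, hF1T⟩ := tailsTwo_topWeight_isClassM y ε₁ w P 2 hy hε₁ hP1 hyP
  -- THE BLOCK BOUND
  have hblk : ∀ X : ℕ, M ≤ X → X ≤ x → ∑ n ∈ Finset.Ioc X (2 * X), wt n ≤
      ((k : ℝ) * y ^ 2 * D * (η ^ y * Bη) * Real.log x ^ e + k * y ^ 2 * (x : ℝ) ^ (-(θ / 2))) * X := by
    intro X hMX hXx
    have hXX₀ : X₀ ≤ X := hMX₀.trans hMX
    have hXr : (x : ℝ) ^ (1 / 2 : ℝ) < X := lt_of_lt_of_le hMsqrt (by exact_mod_cast hMX)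
    have hX0 : (0 : ℝ) < X := lt_of_le_of_lt (by positivity) hXr
    have hX2 : 2 ≤ 2 * X := by omega
    have hXxr : (X : ℝ) ≤ x := by exact_mod_cast hXx
    have hlog2X : Real.log ((2 * X : ℕ) : ℝ) ≤ 2 * Real.log x := by
      have hXr' : ((2 * X : ℕ) : ℝ) ≤ 2 * x := by exact_mod_cast Nat.mul_le_mul_left 2 hXx
      calc Real.log ((2 * X : ℕ) : ℝ) ≤ Real.log (2 * x) := Real.log_le_log (by positivity) hXr'
        _ = Real.log 2 + Real.log x := Real.log_mul two_ne_zero hxpos.ne'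
        _ ≤ 2 * Real.log x := by linarith
    have hXθ : (X : ℝ) ^ (1 - (1 - Real.logb 2 y) / 6) ≤ (x : ℝ) ^ (-(θ / 2)) * X := by
      rw [show (1 : ℝ) - (1 - Real.logb 2 y) / 6 = 1 - θ by rw [hθdef, hlam], Real.rpow_sub hX0, Real.rpow_one,
        div_le_iff₀ (Real.rpow_pos_of_pos hX0 θ)]
      have h1 : (x : ℝ) ^ (θ / 2) ≤ (X : ℝ) ^ θ := by
        calc (x : ℝ) ^ (θ / 2) = ((x : ℝ) ^ (1 / 2 : ℝ)) ^ θ := by rw [← Real.rpow_mul hxpos.le]; ring_nf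
          _ ≤ (X : ℝ) ^ θ := Real.rpow_le_rpow (by positivity) hXr.le hθ.le
      calc (X : ℝ) = (x : ℝ) ^ (-(θ / 2)) * X * (x : ℝ) ^ (θ / 2) := by rw [Real.rpow_neg hxpos.le]; field_simp
        _ ≤ (x : ℝ) ^ (-(θ / 2)) * X * (X : ℝ) ^ θ := mul_le_mul_of_nonneg_left h1 (by positivity)
    have hHp : ∀ j, ∑ m ∈ Finset.Icc 1 (2 * X), y ^ cardFactors (roughPart (P : ℝ) m) * (polyRootCountMod ![f j] m : ℝ) / m ≤
        Cm * 2 ^ y * Real.log x ^ y := by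
      intro j
      calc _ ≤ ∑ m ∈ Finset.Icc 1 (2 * X), y ^ cardFactors m * (polyRootCountMod ![f j] m : ℝ) / m :=
            Finset.sum_le_sum fun m _ => div_le_div_of_nonneg_right (mul_le_mul_of_nonneg_right (hFle m) (Nat.cast_nonneg _)) (Nat.cast_nonneg _)
        _ ≤ Ch' * Real.log ((2 * X : ℕ) : ℝ) ^ y := hCh' j (2 * X) hX2
        _ ≤ Cm * (2 * Real.log x) ^ y := mul_le_mul ((le_max_left _ _).trans (le_max_left _ _))
            (Real.rpow_le_rpow (Real.log_natCast_nonneg _) hlog2X hy0) (Real.rpow_nonneg (Real.log_natCast_nonneg _) y) hCm0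
        _ = Cm * 2 ^ y * Real.log x ^ y := by rw [Real.mul_rpow zero_le_two hlogx.le]; ring
    have hHt : ∀ i, ∑ m ∈ Finset.Icc 1 (2 * X), (y ^ cardFactors (smoothPart w (roughPart (P : ℝ) m)) *
        (if cardFactors (roughPart w (roughPart (P : ℝ) m)) ≤ 2 then (1 : ℝ) else 0)) * (polyRootCountMod ![f i] m : ℝ) / m ≤
        Cm * 2 ^ y * Real.log x ^ y * (η ^ y * Bη) := by
      intro i
      have hA : ∑ a ∈ (Finset.Icc 1 (2 * X)).filter (fun a : ℕ => ∀ p ∈ a.primeFactors, (p : ℝ) ≤ w),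
          y ^ cardFactors a * (polyRootCountMod ![f i] a : ℝ) / a ≤ Cs * (2 * (η * Real.log x)) ^ y := by
        have hwn : 2 ≤ ⌊w⌋₊ := Nat.le_floor (by norm_num; linarith)
        have hfilter : (Finset.Icc 1 (2 * X)).filter (fun a : ℕ => ∀ p ∈ a.primeFactors, (p : ℝ) ≤ w) =
            (Finset.Icc 1 (2 * X)).filter (fun a : ℕ => ∀ p ∈ a.primeFactors, p ≤ ⌊w⌋₊) :=
          Finset.filter_congr fun a _ => forall₂_congr fun p _ => (Nat.le_floor_iff (by linarith)).symm
        rw [hfilter]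
        calc _ ≤ Cs * Real.log (⌊w⌋₊ : ℕ) ^ y := hCs i (2 * X) ⌊w⌋₊ hwn
          _ ≤ Cs * (2 * (η * Real.log x)) ^ y := by
              refine mul_le_mul_of_nonneg_left (Real.rpow_le_rpow (Real.log_natCast_nonneg _) ?_ hy0) hCs0.le
              exact (Real.log_le_log (by positivity) (Nat.floor_le (by linarith))).trans hlogw2
      have hB : ∑ b ∈ (Finset.Icc 1 (2 * X)).filter (fun b : ℕ => (∀ p ∈ b.primeFactors, w < (p : ℝ)) ∧ cardFactors b ≤ 2),
          (polyRootCountMod ![f i] b : ℝ) / b ≤ Bη := by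
        refine (tailsTwo_roughFactor_two_le (f i) Cρ (hρj i) (hρj2 i) w (2 * X)).trans ?_
        rw [hBη]
        refine pow_le_pow_left₀ (by positivity) ?_ 2
        rw [hU₀]
        refine add_le_add (add_le_add le_rfl (mul_le_mul_of_nonneg_left ?_ (Nat.cast_nonneg _))) le_rfl
        rcases le_or_gt w ((2 * X : ℕ) : ℝ) with hwX | hwX
        · refine (hKM w (2 * X) (by linarith) hwX).trans (add_le_add ?_ ?_)
          · refine Real.log_le_log (div_pos (Real.log_pos (by exact_mod_cast (show 1 < 2 * X by omega))) hlogw0) ?_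
            rw [div_le_div_iff₀ hlogw0 hη0]
            nlinarith [hlog2X, hlogw1]
          · rw [div_le_one hlogw0]
            linarith [le_trans (le_max_right _ _) c3]
        · rw [Finset.filter_false_of_mem, Finset.sum_empty]
          · linarith
          · intro p hp h
            have : (p : ℝ) ≤ (2 * X : ℕ) := by exact_mod_cast (Nat.mem_primesLE.mp hp).1
            linarith
      calc _ ≤ ∑ m ∈ Finset.Icc 1 (2 * X), y ^ cardFactors (smoothPart w m) * (if cardFactors (roughPart w m) ≤ 2 then (1 : ℝ) else 0) *
            (polyRootCountMod ![f i] m : ℝ) / m :=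
            Finset.sum_le_sum fun m _ => div_le_div_of_nonneg_right (mul_le_mul_of_nonneg_right (topWeight_le hy hPw m)
              (Nat.cast_nonneg _)) (Nat.cast_nonneg _)
        _ ≤ _ := topHarmonic_le_mul (f i) hy0 w 2 (2 * X)
        _ ≤ Cs * (2 * (η * Real.log x)) ^ y * Bη := mul_le_mul hA hB (Finset.sum_nonneg fun b _ => by positivity) (by positivity)
        _ ≤ Cm * (2 * (η * Real.log x)) ^ y * Bη := by gcongr; exact le_max_right _ _
        _ = Cm * 2 ^ y * Real.log x ^ y * (η ^ y * Bη) := by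
            rw [Real.mul_rpow zero_le_two (by positivity), Real.mul_rpow hη0.le hlogx.le]; ring
    have hI : ∀ i : Fin k, ∑ n ∈ Finset.Ioc X (2 * X), ∏ j, (y ^ cardFactors (smoothPart (P : ℝ) (val f j n)) * FT i j (val f j n)) ≤
        D * (η ^ y * Bη) * ((X : ℝ) * Real.log x ^ e) + (x : ℝ) ^ (-(θ / 2)) * X := by
      intro i
      have hclsi : ∀ j, IsClassM (3 * y) 1 ε₁ (FT i j) := by
        intro j
        by_cases hji : j = i
        · have : FT i j = fun m => y ^ cardFactors (smoothPart w (roughPart (P : ℝ) m)) *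
              (if cardFactors (roughPart w (roughPart (P : ℝ) m)) ≤ 2 then (1 : ℝ) else 0) := by funext m; simp only [hFT, if_pos hji]
          rw [this]; exact IsClassM.mono_A hy0 (by linarith) hclsT
        · have : FT i j = fun m => y ^ cardFactors (roughPart (P : ℝ) m) := by funext m; simp only [hFT, if_neg hji]
          rw [this]; exact hclsP'
      have hFri : ∀ j m, FT i j m = FT i j (roughPart (P : ℝ) m) := by intro j m; simp only [hFT, roughPart_roughPart]
      have hF1i : ∀ j, FT i j 1 ≤ 1 := by
        intro j
        by_cases hji : j = i
        · have : FT i j 1 = y ^ cardFactors (smoothPart w (roughPart (P : ℝ) 1)) *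
              (if cardFactors (roughPart w (roughPart (P : ℝ) 1)) ≤ 2 then (1 : ℝ) else 0) := by simp only [hFT, if_pos hji]
          rw [this]; exact hF1T
        · have : FT i j 1 = y ^ cardFactors (roughPart (P : ℝ) 1) := by simp only [hFT, if_neg hji]
          rw [this]; exact hF1
      have h := hengine (FT i) hclsi hFri hF1i (fun _ => True) X hXX₀
      simp only [Finset.filter_true] at h
      have hZ := Zsum_le_prod (f := f) (P := P) hy0 hKz0 hKz (fun _ => True) X
        (fun _ => (Finset.Icc 1 X).filter (fun m : ℕ => ∀ p ∈ m.primeFactors, p ≤ P))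
        (fun s hs hsP _ j => Finset.mem_filter.mpr ⟨hs j, hsP j⟩)
      have hprodZ : ∏ _j : Fin k, ∑ m ∈ (Finset.Icc 1 X).filter (fun m : ℕ => ∀ p ∈ m.primeFactors, p ≤ P), y ^ cardFactors m / m ≤ (Ks + 1) ^ k := by
        calc _ ≤ ∏ _j : Fin k, (Ks + 1) := Finset.prod_le_prod (fun j _ => Finset.sum_nonneg fun m _ => by positivity) fun j _ => by linarith [hKs X]
          _ = _ := by rw [Finset.prod_const, Finset.card_univ, Fintype.card_fin]
      -- the product of the harmonic factors
      have hH : ∏ j, ∑ m ∈ Finset.Icc 1 (2 * X), FT i j m * (polyRootCountMod ![f j] m : ℝ) / m ≤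
          (Cm * 2 ^ y) ^ k * Real.log x ^ (y * k) * (η ^ y * Bη) := by
        rw [← Finset.mul_prod_erase _ _ (Finset.mem_univ i)]
        have h1 : ∑ m ∈ Finset.Icc 1 (2 * X), FT i i m * (polyRootCountMod ![f i] m : ℝ) / m ≤ Cm * 2 ^ y * Real.log x ^ y * (η ^ y * Bη) := by
          simp only [hFT, if_true]; exact hHt i
        have h2 : ∏ j ∈ Finset.univ.erase i, ∑ m ∈ Finset.Icc 1 (2 * X), FT i j m * (polyRootCountMod ![f j] m : ℝ) / m ≤
            (Cm * 2 ^ y * Real.log x ^ y) ^ (k - 1) := by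
          calc _ ≤ ∏ _j ∈ Finset.univ.erase i, (Cm * 2 ^ y * Real.log x ^ y) := by
                refine Finset.prod_le_prod (fun j _ => Finset.sum_nonneg fun m _ => div_nonneg (mul_nonneg ((hclsi j).1 m)
                  (Nat.cast_nonneg _)) (Nat.cast_nonneg _)) fun j hj => ?_
                simp only [hFT, if_neg (Finset.ne_of_mem_erase hj)]; exact hHp j
            _ = _ := by rw [Finset.prod_const, Finset.card_erase_of_mem (Finset.mem_univ i), Finset.card_univ, Fintype.card_fin]
        have h3 : 0 ≤ ∏ j ∈ Finset.univ.erase i, ∑ m ∈ Finset.Icc 1 (2 * X), FT i j m * (polyRootCountMod ![f j] m : ℝ) / m :=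
          Finset.prod_nonneg fun j _ => Finset.sum_nonneg fun m _ => div_nonneg (mul_nonneg ((hclsi j).1 m) (Nat.cast_nonneg _)) (Nat.cast_nonneg _)
        calc _ ≤ (Cm * 2 ^ y * Real.log x ^ y * (η ^ y * Bη)) * (Cm * 2 ^ y * Real.log x ^ y) ^ (k - 1) :=
              mul_le_mul h1 h2 h3 (by positivity)
          _ = (Cm * 2 ^ y * Real.log x ^ y) ^ k * (η ^ y * Bη) := by
              conv_rhs => rw [show k = k - 1 + 1 by omega, pow_succ]
              ring
          _ = (Cm * 2 ^ y) ^ k * Real.log x ^ (y * k) * (η ^ y * Bη) := by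
              rw [mul_pow, ← Real.rpow_natCast (Real.log x ^ y) k, ← Real.rpow_mul hlogx.le]
      have hek : y * k - k = e := by rw [he]; ring
      refine h.trans (add_le_add ?_ hXθ)
      have key : ∀ Zs : ℝ, 0 ≤ Zs → Zs ≤ Kz * (Ks + 1) ^ k →
          C * ((X : ℝ) / Real.log X ^ k) * (∏ j, ∑ m ∈ Finset.Icc 1 (2 * X), FT i j m * (polyRootCountMod ![f j] m : ℝ) / m) * Zs ≤
            D * (η ^ y * Bη) * ((X : ℝ) * Real.log x ^ e) := by
        intro Zs hZs0 hZsle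
        calc _ ≤ C * ((X : ℝ) / Real.log X ^ k) * ((Cm * 2 ^ y) ^ k * Real.log x ^ (y * k) * (η ^ y * Bη)) * Zs :=
              mul_le_mul_of_nonneg_right (mul_le_mul_of_nonneg_left hH (by positivity)) hZs0
          _ = C * ((X : ℝ) / Real.log X ^ k) * ((Cm * 2 ^ y) ^ k * Real.log x ^ (y * k)) * ((η ^ y * Bη) * Zs) := by ring
          _ ≤ C * 2 ^ k * (Cm * 2 ^ y) ^ k * ((X : ℝ) * Real.log x ^ (y * k - k)) * ((η ^ y * Bη) * Zs) :=
              engine_mainTerm_le hC0 hCm0 hx1 hXr (by positivity) le_rfl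
          _ ≤ C * 2 ^ k * (Cm * 2 ^ y) ^ k * ((X : ℝ) * Real.log x ^ (y * k - k)) * ((η ^ y * Bη) * (Kz * (Ks + 1) ^ k)) := by
              gcongr
          _ = D * (η ^ y * Bη) * ((X : ℝ) * Real.log x ^ e) := by rw [hD, hek]; ring
      refine key _ ?_ ?_
      · exact Finset.sum_nonneg fun s _ => div_nonneg (mul_nonneg (pow_nonneg hy0 _) (Nat.cast_nonneg _)) (Nat.cast_nonneg _)
      · convert hZ.trans (mul_le_mul_of_nonneg_left hprodZ hKz0) using 2
    -- pointwise: on the balanced class the tilt is `y² ×` the engine summand (one member)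
    have hpt : ∀ n ∈ Finset.Ioc X (2 * X), wt n ≤ ∑ i, y ^ 2 * ∏ j, (y ^ cardFactors (smoothPart (P : ℝ) (val f j n)) * FT i j (val f j n)) := by
      intro n hn
      have hterm0 : ∀ i, 0 ≤ y ^ 2 * ∏ j, (y ^ cardFactors (smoothPart (P : ℝ) (val f j n)) * FT i j (val f j n)) := fun i =>
        mul_nonneg (by positivity) (Finset.prod_nonneg fun j _ => mul_nonneg (pow_nonneg hy0 _) (hFT0 i j _))
      simp only [hwt]
      split_ifs with hc
      · obtain ⟨p, hp, q, hq, hpq, hxp, hxq⟩ := hc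
        rw [hprodVal n] at hp hq
        refine le_trans (le_of_eq ?_) (Finset.single_le_sum (fun i _ => hterm0 i) (Finset.mem_univ i₀))
        have hnX : n ≤ 2 * X := (Finset.mem_Ioc.mp hn).2
        have hn1 : 1 ≤ n := by have := (Finset.mem_Ioc.mp hn).1; omega
        have hx1η : (x : ℝ) ^ (1 - η) ≤ (x : ℝ) ^ (1 - η / 2) := Real.rpow_le_rpow_of_exponent_le hx1.le (by linarith)
        have hwp : w < (p : ℝ) := lt_of_lt_of_le (hwx.trans_le hx1η) hxp.le
        have hwq : w < (q : ℝ) := lt_of_lt_of_le (hwx.trans_le hx1η) hxq.le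
        have hval : (val f i₀ n : ℝ) < w * p * q := by
          have h1 := hHc i₀ n hn1
          rw [hdeg₀] at h1
          have hn2x : (n : ℝ) ≤ 2 * x := by
            have : n ≤ 2 * x := hnX.trans (Nat.mul_le_mul_left 2 hXx)
            exact_mod_cast this
          have e3 : (x : ℝ) ^ (1 - η / 2) * (x : ℝ) ^ (1 - η / 2) * (x : ℝ) ^ η = (x : ℝ) ^ 2 := by
            rw [← Real.rpow_add hxpos, ← Real.rpow_add hxpos, show 1 - η / 2 + (1 - η / 2) + η = ((2 : ℕ) : ℝ) by push_cast; ring,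
              Real.rpow_natCast]
          have h2 : (n : ℝ) ^ 2 ≤ 4 * ((x : ℝ) ^ (1 - η / 2) * (x : ℝ) ^ (1 - η / 2)) * (x : ℝ) ^ η := by
            calc (n : ℝ) ^ 2 ≤ (2 * x) ^ 2 := pow_le_pow_left₀ (Nat.cast_nonneg n) hn2x 2
              _ = 4 * ((x : ℝ) ^ (1 - η / 2) * (x : ℝ) ^ (1 - η / 2) * (x : ℝ) ^ η) := by rw [e3]; ring
              _ = _ := by ring
          calc (val f i₀ n : ℝ) ≤ Hc * (n : ℝ) ^ 2 := h1
            _ ≤ Hc * (4 * ((x : ℝ) ^ (1 - η / 2) * (x : ℝ) ^ (1 - η / 2)) * (x : ℝ) ^ η) := mul_le_mul_of_nonneg_left h2 (by positivity)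
            _ = w * ((x : ℝ) ^ (1 - η / 2) * (x : ℝ) ^ (1 - η / 2)) := by rw [hwdef]; ring
            _ < w * (p * q) := mul_lt_mul_of_pos_left (mul_lt_mul'' hxp hxq (by positivity) (by positivity)) (by linarith)
            _ = w * p * q := by ring
        have hrw : roughPart w (val f i₀ n) = p * q := roughPart_eq_of_two_primes_dvd hp hq hpq hwp hwq hval
        have hΩ2 : cardFactors (roughPart w (val f i₀ n)) = 2 := by
          rw [hrw, ArithmeticFunction.cardFactors_mul (Nat.prime_of_mem_primeFactors hp).ne_zero (Nat.prime_of_mem_primeFactors hq).ne_zero,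
            ArithmeticFunction.cardFactors_apply_prime (Nat.prime_of_mem_primeFactors hp),
            ArithmeticFunction.cardFactors_apply_prime (Nat.prime_of_mem_primeFactors hq)]
        rw [pow_stat_eq_balSummand f hPw n i₀ hΩ2]
      · exact Finset.sum_nonneg fun i _ => hterm0 i
    refine (Finset.sum_le_sum hpt).trans ?_
    rw [Finset.sum_comm, Finset.sum_congr rfl fun i _ => (Finset.mul_sum (Finset.Ioc X (2 * X))
      (fun n => ∏ j, (y ^ cardFactors (smoothPart (P : ℝ) (val f j n)) * FT i j (val f j n))) (y ^ 2)).symm]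
    calc ∑ i, y ^ 2 * ∑ n ∈ Finset.Ioc X (2 * X), ∏ j, (y ^ cardFactors (smoothPart (P : ℝ) (val f j n)) * FT i j (val f j n))
        ≤ ∑ _i : Fin k, y ^ 2 * (D * (η ^ y * Bη) * ((X : ℝ) * Real.log x ^ e) + (x : ℝ) ^ (-(θ / 2)) * X) :=
          Finset.sum_le_sum fun i _ => mul_le_mul_of_nonneg_left (hI i) (by positivity)
      _ = ((k : ℝ) * y ^ 2 * D * (η ^ y * Bη) * Real.log x ^ e + k * y ^ 2 * (x : ℝ) ^ (-(θ / 2))) * X := by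
          rw [Finset.sum_const, Finset.card_univ, Fintype.card_fin, nsmul_eq_mul]; ring
  have hE₂ : 2 * ((k : ℝ) * y ^ 2 * (x : ℝ) ^ (-(θ / 2))) ≤ ε / 4 * Real.log x ^ e := by
    have hxθ : 0 < (x : ℝ) ^ (θ / 2) := Real.rpow_pos_of_pos hxpos _
    have h1 : 32 * k * y ^ 2 / (ε * Real.log 2 ^ e) ≤ (x : ℝ) ^ (θ / 2) := c8
    rw [div_le_iff₀ (by positivity)] at h1
    have h2 : Real.log 2 ^ e ≤ Real.log x ^ e := Real.rpow_le_rpow (Real.log_nonneg one_le_two) hlog2x he0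
    rw [Real.rpow_neg hxpos.le, show 2 * ((k : ℝ) * y ^ 2 * ((x : ℝ) ^ (θ / 2))⁻¹) = (2 * k * y ^ 2) / (x : ℝ) ^ (θ / 2) by ring,
      div_le_iff₀ hxθ]
    calc 2 * (k : ℝ) * y ^ 2 = (32 * k * y ^ 2) / 16 := by ring
      _ ≤ (x : ℝ) ^ (θ / 2) * (ε * Real.log 2 ^ e) / 16 := by gcongr
      _ ≤ (x : ℝ) ^ (θ / 2) * (ε * Real.log x ^ e) / 16 := by gcongr
      _ ≤ ε / 4 * Real.log x ^ e * (x : ℝ) ^ (θ / 2) := by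
          rw [show (x : ℝ) ^ (θ / 2) * (ε * Real.log x ^ e) / 16 = (ε / 4 * Real.log x ^ e * (x : ℝ) ^ (θ / 2)) * (1 / 4) by ring]
          exact mul_le_of_le_one_right (by positivity) (by norm_num)
  have hCa' : Ca * (2 * (x : ℝ) ^ (1 / 2 : ℝ) + 2) ≤ ε / 4 * x := by
    have ha : 16 * (Ca + 1) / ε ≤ (x : ℝ) ^ (1 / 2 : ℝ) := c6
    have hb : 16 * (Ca + 1) / ε ≤ x := c7
    rw [div_le_iff₀ hε] at ha hb
    calc Ca * (2 * (x : ℝ) ^ (1 / 2 : ℝ) + 2) ≤ (Ca + 1) * (2 * (x : ℝ) ^ (1 / 2 : ℝ) + 2) :=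
          mul_le_mul_of_nonneg_right (by linarith) (by positivity)
      _ = 2 * ((Ca + 1) * (x : ℝ) ^ (1 / 2 : ℝ)) + 2 * (Ca + 1) := by ring
      _ ≤ 2 * (((x : ℝ) ^ (1 / 2 : ℝ) * ε / 16) * (x : ℝ) ^ (1 / 2 : ℝ)) + 2 * ((x : ℝ) * ε / 16) := by
          gcongr
          · linarith
          · linarith
      _ = ε / 8 * ((x : ℝ) ^ (1 / 2 : ℝ) * (x : ℝ) ^ (1 / 2 : ℝ)) + ε / 8 * x := by ring
      _ = ε / 4 * x := by rw [hsqx]; ring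
  have hlhs : ∑ n ∈ (Finset.Icc 1 x).filter (fun n : ℕ => ∃ p ∈ (prodVal f n).primeFactors, ∃ q ∈ (prodVal f n).primeFactors,
      p ≠ q ∧ (x : ℝ) ^ (1 - η / 2) < (p : ℝ) ∧ (x : ℝ) ^ (1 - η / 2) < (q : ℝ)), y ^ stat f n = ∑ n ∈ Finset.Icc 1 x, wt n := by
    rw [Finset.sum_filter]
  rw [hlhs]
  exact tailsTwo_assembly k f y e ε Ca ((k : ℝ) * y ^ 2 * D * (η ^ y * Bη)) ((k : ℝ) * y ^ 2 * (x : ℝ) ^ (-(θ / 2))) wt M x hy0 he0 hCa0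
    (by positivity) (by positivity) hwt0 hwtle hCa hM1 hMsqrt hMle h2Mx hx8 hblk hE₁ hE₂ hCa'

end

end Summit.Parity.BatemanHorn.Cruxes.LSDRealSegment.ProductAnatomySubcritical
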